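import Summits.Parity.GeneralizedHardyLittlewood.Theorems.RangeQualityExchangeNecessity

/-!
# Range–quality exchange (helper for stmt-Parity-26853 `UniformUpperGivenFixed`): the shift-RANGE dial of
# the uniformity leaves and the QUALITY dial of the Siegel leaves are ONE dial (5/5: the exchange table, summary, wiring)

Part of the decomp-parity lens-5 g10 certificate «RangeQualityExchange» (NODE HOME/STATUS.md l.484, critic CLEARED l.490 =
CRITIC-LEDGER row 89, writer DECISION L7 l.491: zero credit, helper beneath the existing leaf UU 26853), landed from the lens hand
`HOME/decomp-parity-lens-5/g10/hand/RangeQualityExchange.lean` (sha16 fc7ece3ca225b2c0, 1301 lines, rc 0 · 0 sorry · standard axioms)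
VERBATIM by section in five files for the 400-line Theorems lint by the cell's prover-class seat census-1 g10
(`RangeQualityExchangeCore` → `RangeQualityExchangeCoreLower` → `RangeQualityExchangeRate` → `RangeQualityExchangeNecessity` →
`RangeQualityExchange`; vocabulary `Theorems/RangeQualityExchangeDefs.lean`, p772649).  The hand's `private` shift-pair dictionary
copies (of `Theorems/PairsToGHL/Negative/{ShiftPairDictionary,UnboundedSiegelZeros}.lean`, which do not build on the current farm
snapshot, remote:stale:unbuilt 2026-08-30) stay `private` and sit in the part(s) that use them.

Ported from the decomp-parity lens-5 g10 certificate kernel `HOME/decomp-parity-lens-5/g10/RangeQualityExchange.lean`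
onto the BORN decls of `Theses/SiegelSpectrumSplit.lean` (`BoundedSiegelZeroQuality`, `FixedUpper`,
`UniformUpperGivenFixed`, `FixedLower`, `UniformLowerGivenFixed`, `HighBandZeroFree`, used BY NAME).

Record tree (route-Parity-SiegelSpectrumSplit): `GHL ⟸ Q ∧ UQ ∧ LQ`, `Q ⟸ H ∧ L` (G1.1, quality bands
`(log D)^2024`), `UQ ⟸ FU ∧ UU`, `LQ ⟸ FL ∧ UL` (G1.2, fixed vs shift-uniform). G1.1 dials the QUALITY
`η` of exceptional zeros; G1.2 dials the SHIFT RANGE `h ≤ R(N)` over which Hardy–Littlewood must hold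
uniformly. This file proves (mod the vendored Matomäki–Merikoski Theorem 1.3, as every MM edge of the
record) that the two dials are coupled by an explicit EXCHANGE RATE, so that no cell of lens 5 lies
between them:

* `UniformUpperUpTo R` / `UniformLowerUpTo R` — bare (unconditioned) one-sided pair Hardy–Littlewood,
  uniform over even shifts `h ≤ min(N, R N)` (necessary: `GHL →` both, for every `R`,
  `uniformUpperUpTo_of_ghl`).
* `RangeReachingZeros R` — exceptional zeros whose Matomäki–Merikoski scale window `X = q^V`,
  `10 ≤ V ≤ δ η / log⁶ η`, reaches the range: `2q ≤ R(q^V)`. CORE (template = the record kernel's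
  `not_upperGHL_of_unboundedSiegelZeros` with the scale exponent `V` freed):
  `RangeReachingZeros R → ¬ UniformUpperUpTo R` and `RangeReachingZerosFour R → ¬ UniformLowerUpTo R`.
* EXCHANGE RATE. Polynomial ranges `R N = N^θ` are reached by zeros of merely unbounded quality
  (`rangeReachingZeros_pow_of_unboundedSiegelZeros`, `V` constant), so `UniformUpperUpTo (·^θ) → Q`
  for every `θ > 0`: the record's `Q →` conditioning is already necessary at every polynomial range.
  Stretched ranges `R N = exp((log N)^κ)`, `0 < κ ≤ 1`, are reached by zeros of quality
  `η ≥ (log q)^B` as soon as `B > 1/κ - 1` (`rangeReachingZeros_stretched_of_qualityAbove`), and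
  conversely a reaching zero has quality `≥ (log q)^{1/κ-1}`
  (`qualityAbove_of_rangeReachingZeros_stretched`), so `UniformUpperUpTo (exp((log ·)^κ)) →
  ¬ QualityAbove B`: RANGE EXPONENT `κ` ⟷ QUALITY EXPONENT `A = 1/κ - 1`, exactly. A polylog
  zero-free region `ZeroFreeRegion A` (`A = 2024` is the record's special band `H = HighBandZeroFree`,
  Zhang's claimed Theorem 2) gives `¬ QualityAbove B` for every `B > A - 1`
  (`not_qualityAbove_of_zeroFreeRegion`), hence NO zero reaches `exp((log N)^κ)` for `κ < 1/A`
  (`not_rangeReachingZeros_stretched_of_zeroFreeRegion`): below range `exp((log N)^{1/2024})` the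
  record's `Q →` conditioning of UU/UL is not forced by this mechanism, `H` discharges it. POLYLOG
  ranges `R N = c (log N)^A` are reached by NO zero at all, by Siegel's theorem
  (`not_rangeReachingZeros_polylog`, tree `exists_siegelZero_quality_le`, PROVED): the finite/short
  base range of the shift dial is SIEGEL-INERT.

Consequence for the lens (memo NODE-g10.md): cutting UU/UL by shift range re-dials G1.1 (trap: RANGE–
QUALITY EXCHANGE); no new piece is filed. [cite: MatomakiMerikoski2023, Theorem 1.3]
[cite: GreenTao2010, Conjecture 1.2] [cite: MontgomeryVaughan2007, Cor. 11.15]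
-/

open Finset Filter MeasureTheory
open scoped Topology ArithmeticFunction.vonMangoldt
open Literature.NumberTheory.Sieve Literature.Barriers.Parity
open Summit.Parity.GeneralizedHardyLittlewood.Theses

noncomputable section

namespace Summit.Parity.GeneralizedHardyLittlewood.RangeQualityExchange

/-! ## The exchange table (necessity edges extracted from each cell) -/


/-- The record residual `Q` (stmt-Parity-25148, BY NAME) `↔ ¬ UnboundedSiegelZeros`. [folklore] -/
theorem boundedSiegelZeroQuality_iff_not_unbounded :
    SiegelSpectrumSplit.BoundedSiegelZeroQuality ↔ ¬ UnboundedSiegelZeros := by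
  constructor
  · rintro ⟨η₀, q₀, h⟩ hU
    obtain ⟨q, inst, χ, η, hq, hη, hz⟩ := hU η₀ q₀
    exact absurd (h q χ η hq hz) (not_lt.mpr hη)
  · intro h
    by_contra hB
    apply h
    intro η₀ q₀
    by_contra hne
    apply hB
    refine ⟨η₀, q₀, fun q _ χ η hq hz => ?_⟩
    by_contra hlt
    exact hne ⟨q, inferInstance, χ, η, hq, not_lt.mp hlt, hz⟩

/-- **Row 1 of the table (every POLYNOMIAL range already costs `Q`).** For every `θ > 0`, uniform upper
pair-HL over shifts `h ≤ N^θ` implies bounded Siegel-zero quality (mod MM): the record's `Q →`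
conditioning of the uniformity leaf is NECESSARY at every polynomial range, not only at `h ≍ N`.
[cite: MatomakiMerikoski2023, Theorem 1.3] -/
theorem boundedSiegelZeroQuality_of_uniformUpperUpTo_pow (hMM : MatomakiMerikoski2023_pairCorrelation)
    {θ : ℝ} (hθ : 0 < θ) (h : UniformUpperUpTo (fun N => (N : ℝ) ^ θ)) : SiegelSpectrumSplit.BoundedSiegelZeroQuality :=
  boundedSiegelZeroQuality_iff_not_unbounded.mpr fun hU =>
    not_uniformUpperUpTo_of_rangeReachingZeros hMM (rangeReachingZeros_pow_of_unboundedSiegelZeros hθ hU) h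

/-- Row 1, lower side: uniform lower pair-HL over `h ≤ N^θ` bounds the quality of Siegel zeros at
conductors `4 ∣ q` (mod MM). [cite: MatomakiMerikoski2023, Theorem 1.3] -/
theorem not_unboundedFour_of_uniformLowerUpTo_pow (hMM : MatomakiMerikoski2023_pairCorrelation)
    {θ : ℝ} (hθ : 0 < θ) (h : UniformLowerUpTo (fun N => (N : ℝ) ^ θ)) :
    ¬ UnboundedSiegelZerosFour := fun hU =>
  not_uniformLowerUpTo_of_rangeReachingZerosFour hMM
    (rangeReachingZerosFour_pow_of_unboundedSiegelZerosFour hθ hU) h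

/-- **Row 2 (STRETCHED ranges: range exponent `κ` ⟷ quality exponent `1/κ - 1`).** Uniform upper
pair-HL over shifts `h ≤ exp((log N)^κ)`, `0 < κ ≤ 1`, excludes Siegel zeros of quality `(log q)^B`
at large conductors for every `B > 1/κ - 1` (mod MM) — a polylog zero-free region in quality form.
[cite: MatomakiMerikoski2023, Theorem 1.3] -/
theorem not_qualityAbove_of_uniformUpperUpTo_stretched (hMM : MatomakiMerikoski2023_pairCorrelation)
    {κ B : ℝ} (hκ0 : 0 < κ) (hκ1 : κ ≤ 1) (hB : 1 / κ - 1 < B)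
    (h : UniformUpperUpTo (fun N => Real.exp (Real.log N ^ κ))) : ¬ QualityAbove B := fun hQ =>
  not_uniformUpperUpTo_of_rangeReachingZeros hMM
    (rangeReachingZeros_stretched_of_qualityAbove hκ0 hκ1 hB hQ) h

/-- Row 2, lower side. [cite: MatomakiMerikoski2023, Theorem 1.3] -/
theorem not_qualityAboveFour_of_uniformLowerUpTo_stretched
    (hMM : MatomakiMerikoski2023_pairCorrelation) {κ B : ℝ} (hκ0 : 0 < κ) (hκ1 : κ ≤ 1)
    (hB : 1 / κ - 1 < B) (h : UniformLowerUpTo (fun N => Real.exp (Real.log N ^ κ))) :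
    ¬ QualityAboveFour B := fun hQ =>
  not_uniformLowerUpTo_of_rangeReachingZerosFour hMM
    (rangeReachingZerosFour_stretched_of_qualityAboveFour hκ0 hκ1 hB hQ) h

/-- **The special band discharges the stretched rows.** A polylog zero-free region of exponent `A`
(`Zhang2022.Skeleton.ZeroFreeRegion A`; `A = 2024` is the record item `HighBandZeroFree` = Zhang's
claimed Theorem 2) excludes quality `(log q)^B` for every `B > A - 1`: a zero `1 - 1/(η log q)` with
`η ≥ (log q)^B` lies right of `1 - c₂/(log q)^A` once `c₂ (log q)^{B-(A-1)} > 1`. Hence for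
`κ < 1/A` the Landau–Siegel content that Matomäki–Merikoski extracts from range-`κ` uniformity is at
most `ZeroFreeRegion A`-strength (`not_rangeReachingZeros_stretched_of_zeroFreeRegion`).
[cite: Zhang2022LandauSiegel, Theorem 2] -/
theorem not_qualityAbove_of_zeroFreeRegion {A : ℕ}
    (hZ : Literature.NumberTheory.LFunctions.Zhang2022.Skeleton.ZeroFreeRegion A) {B : ℝ}
    (hB : (A : ℝ) - 1 < B) : ¬ QualityAbove B := by
  intro hQ
  obtain ⟨c₂, hc₂, hfree⟩ := hZ
  have hBA : 0 < B - ((A : ℝ) - 1) := by linarith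
  have hev : ∀ᶠ q : ℕ in atTop, 1 < c₂ * Real.log (q : ℝ) ^ (B - ((A : ℝ) - 1)) :=
    ((tendsto_log_natCast_rpow hBA).const_mul_atTop hc₂).eventually_gt_atTop 1
  obtain ⟨q₁, hq₁⟩ := eventually_atTop.mp (hev.and (eventually_ge_atTop 3))
  obtain ⟨q, inst, χ, η, hq, hqual, hprim, hquad, hη10, hL⟩ := hQ q₁
  obtain ⟨hbig, hq3⟩ := hq₁ q hq
  have hq3r : (3 : ℝ) ≤ q := by exact_mod_cast hq3
  have hlogq : 1 < Real.log q := by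
    rw [Real.lt_log_iff_exp_lt (by linarith)]
    exact lt_of_lt_of_le (by have := Real.exp_one_lt_d9; norm_num at this ⊢; linarith) hq3r
  have hlogpos : 0 < Real.log q := by linarith
  have hηpos : 0 < η := by linarith
  -- `(log q)^A < c₂ η log q`
  have hkey : Real.log q ^ A < c₂ * (η * Real.log q) := by
    have hsplit : Real.log q ^ B = Real.log q ^ ((A : ℝ) - 1) * Real.log q ^ (B - ((A : ℝ) - 1)) := by
      rw [← Real.rpow_add hlogpos]; congr 1; ring
    have hA1 : Real.log q ^ ((A : ℝ) - 1) * Real.log q = Real.log q ^ A := by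
      rw [← Real.rpow_natCast, ← Real.rpow_add_one hlogpos.ne']; congr 1; ring
    have hpow0 : 0 < Real.log q ^ ((A : ℝ) - 1) := Real.rpow_pos_of_pos hlogpos _
    calc Real.log q ^ A = Real.log q ^ ((A : ℝ) - 1) * 1 * Real.log q := by rw [mul_one, hA1]
      _ < Real.log q ^ ((A : ℝ) - 1) * (c₂ * Real.log q ^ (B - ((A : ℝ) - 1))) * Real.log q := by
          gcongr
      _ = c₂ * (Real.log q ^ B * Real.log q) := by rw [hsplit]; ring
      _ ≤ c₂ * (η * Real.log q) := by gcongr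
  have hσ : 1 - c₂ / Real.log q ^ A < 1 - 1 / (η * Real.log q) := by
    have h1 : 1 / (η * Real.log q) < c₂ / Real.log q ^ A := by
      rw [div_lt_div_iff₀ (by positivity) (by positivity), one_mul]
      exact hkey
    linarith
  exact hfree q χ hq3 hquad hprim (1 - 1 / (η * Real.log q)) hσ hL

/-- **The special band DISCHARGES the Matomäki–Merikoski obstruction at short stretched ranges.**
`ZeroFreeRegion A` (`A = 2024`: the record item `H = HighBandZeroFree`) leaves no zero reaching
`exp((log N)^κ)` for any `κ < 1/A`; in particular below range `exp((log N)^{1/2024})` the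
conditioning of the uniformity leaves on the full finite range `Q` is not forced by this mechanism —
`H` alone removes the known obstruction. [cite: Zhang2022LandauSiegel, Theorem 2]
[cite: MatomakiMerikoski2023, Theorem 1.3] -/
theorem not_rangeReachingZeros_stretched_of_zeroFreeRegion {A : ℕ}
    (hZ : Literature.NumberTheory.LFunctions.Zhang2022.Skeleton.ZeroFreeRegion A) {κ : ℝ}
    (hκ0 : 0 < κ) (hκA : κ < 1 / (A : ℝ)) :
    ¬ RangeReachingZeros (fun N => Real.exp (Real.log N ^ κ)) := by
  intro h
  rcases Nat.eq_zero_or_pos A with hA0 | hApos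
  · subst hA0; simp at hκA; linarith
  have hAr : (0 : ℝ) < A := by exact_mod_cast hApos
  have hB : (A : ℝ) - 1 < 1 / κ - 1 := by
    have h1 : κ * A < 1 := (lt_div_iff₀ hAr).mp hκA
    have h2 : (A : ℝ) < 1 / κ := by rw [lt_div_iff₀ hκ0]; linarith [mul_comm κ (A : ℝ)]
    linarith
  exact not_qualityAbove_of_zeroFreeRegion hZ hB (qualityAbove_of_rangeReachingZeros_stretched hκ0 h)

/-- **Row 3 (POLYLOG ranges are SIEGEL-INERT).** No Siegel zero reaches a polylog range
`R N = c (log N)^A`: reach would need `2q ≤ c (V log q)^A` with `V ≤ η`, i.e. `η ≫ q^{1/A}/log q`,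
against Siegel's theorem `η ≪_ε q^ε` (tree: `exists_siegelZero_quality_le`, PROVED). So the
finite/short base range of the shift dial carries no Landau–Siegel content extractable by the
Matomäki–Merikoski mechanism — the lens-5 "base range" is inert here.
[cite: MontgomeryVaughan2007, Cor. 11.15] [cite: MatomakiMerikoski2023, (1.3)] -/
theorem not_rangeReachingZeros_polylog {A c : ℝ} (hA : 0 < A) (hc : 0 < c) :
    ¬ RangeReachingZeros (fun N => c * Real.log N ^ A) := by
  intro hZ
  obtain ⟨CS, hCS, hSiegel⟩ := exists_siegelZero_quality_le (ε := 1 / (2 * A)) (by positivity)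
  set C : ℝ := CS ^ A with hC
  have hCpos : 0 < C := Real.rpow_pos_of_pos hCS A
  -- eventually `c C (log q)^A < q^{1/2}`
  have hev : ∀ᶠ q : ℕ in atTop, Real.log (q : ℝ) ^ A / (q : ℝ) ^ (1 / 2 : ℝ) < 1 / (c * C) :=
    ((isLittleO_log_rpow_rpow_atTop A (by norm_num : (0 : ℝ) < 1 / 2)).tendsto_div_nhds_zero.comp
      tendsto_natCast_atTop_atTop).eventually (gt_mem_nhds (by positivity))
  obtain ⟨q₁, hq₁⟩ := eventually_atTop.mp (hev.and (eventually_ge_atTop 2))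
  obtain ⟨q, inst, χ, η, V, hq, -, hz, hV10, hVη, hreach⟩ := hZ 1 one_pos 10 q₁
  obtain ⟨hsmall, hq2⟩ := hq₁ q hq
  have hη10 : 10 ≤ η := hz.ten_le
  have hηpos : 0 < η := by linarith
  have hq2r : (2 : ℝ) ≤ q := by exact_mod_cast hq2
  have hqpos : (0 : ℝ) < q := by linarith
  have hlogq : 0 < Real.log q := Real.log_pos (by linarith)
  have hsqrt : 0 < (q : ℝ) ^ (1 / 2 : ℝ) := Real.rpow_pos_of_pos hqpos _
  -- `V ≤ η ≤ CS q^{1/(2A)}`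
  have hlogη : 1 ≤ Real.log η := by
    rw [Real.le_log_iff_exp_le hηpos]
    have := Real.exp_one_lt_d9; norm_num at this; linarith
  have hVη' : (V : ℝ) ≤ η := by
    have h1 : (V : ℝ) * Real.log η ^ 6 ≤ 1 * η := (div_le_iff₀ hηpos).mp hVη
    have h6 : 1 ≤ Real.log η ^ 6 := one_le_pow₀ hlogη
    nlinarith [Nat.cast_nonneg (α := ℝ) V]
  have hηS : η ≤ CS * (q : ℝ) ^ (1 / (2 * A)) := hSiegel q χ η hz
  -- reach says `2q ≤ c (V log q)^A`
  have hreach' : ((2 * q : ℕ) : ℝ) ≤ c * ((V : ℝ) * Real.log q) ^ A := by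
    have := hreach
    simp only [Nat.cast_pow, Real.log_pow] at this
    exact this
  have hbound : ((V : ℝ) * Real.log q) ^ A ≤ C * (q : ℝ) ^ (1 / 2 : ℝ) * Real.log q ^ A := by
    calc ((V : ℝ) * Real.log q) ^ A ≤ (CS * (q : ℝ) ^ (1 / (2 * A)) * Real.log q) ^ A :=
          Real.rpow_le_rpow (by positivity)
            (mul_le_mul_of_nonneg_right (hVη'.trans hηS) hlogq.le) hA.le
      _ = C * (q : ℝ) ^ (1 / 2 : ℝ) * Real.log q ^ A := by
          rw [Real.mul_rpow (by positivity) hlogq.le, Real.mul_rpow hCS.le (Real.rpow_nonneg hqpos.le _),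
            ← Real.rpow_mul hqpos.le, hC]
          congr 2
          field_simp
  have hClog : c * C * Real.log q ^ A < (q : ℝ) ^ (1 / 2 : ℝ) := by
    have := (div_lt_iff₀ hsqrt).mp hsmall
    have hcC : 0 < c * C := by positivity
    calc c * C * Real.log q ^ A < c * C * (1 / (c * C) * (q : ℝ) ^ (1 / 2 : ℝ)) :=
          mul_lt_mul_of_pos_left this hcC
      _ = (q : ℝ) ^ (1 / 2 : ℝ) := by field_simp
  have hqq : (q : ℝ) ^ (1 / 2 : ℝ) * (q : ℝ) ^ (1 / 2 : ℝ) = q := by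
    rw [← Real.rpow_add hqpos]; norm_num
  have h2q : ((2 * q : ℕ) : ℝ) < q := by
    calc ((2 * q : ℕ) : ℝ) ≤ c * (C * (q : ℝ) ^ (1 / 2 : ℝ) * Real.log q ^ A) :=
          hreach'.trans (mul_le_mul_of_nonneg_left hbound hc.le)
      _ = (q : ℝ) ^ (1 / 2 : ℝ) * (c * C * Real.log q ^ A) := by ring
      _ < (q : ℝ) ^ (1 / 2 : ℝ) * (q : ℝ) ^ (1 / 2 : ℝ) := mul_lt_mul_of_pos_left hClog hsqrt
      _ = q := hqq
  have : (2 : ℝ) * q ≤ ((2 * q : ℕ) : ℝ) := by push_cast; exact le_rfl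
  linarith

/-- Row 3 with `c = 1`. [cite: MontgomeryVaughan2007, Cor. 11.15] -/
theorem not_rangeReachingZeros_polylog_one {A : ℝ} (hA : 0 < A) :
    ¬ RangeReachingZeros (fun N => Real.log N ^ A) := by
  have h := not_rangeReachingZeros_polylog hA one_pos
  simpa only [one_mul] using h

/-- Lower-side family: a `4 ∣ q` zero reaching `(log N)^A` with the deficit shift `q/2` reaches
`4 (log N)^A` with the excess shift `2q`. [folklore] -/
theorem rangeReachingZeros_of_four_polylog {A : ℝ}
    (h : RangeReachingZerosFour (fun N => Real.log N ^ A)) :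
    RangeReachingZeros (fun N => 4 * Real.log N ^ A) := by
  intro δ hδ η₀ q₀
  obtain ⟨q, inst, χ, η, V, hq, hη, h4, hz, hV, hVη, hreach⟩ := h δ hδ η₀ (max q₀ 4)
  refine ⟨q, inst, χ, η, V, le_of_max_le_left hq, hη, hz, hV, hVη, ?_⟩
  have hcast : ((2 * q : ℕ) : ℝ) ≤ 4 * ((q / 2 : ℕ) : ℝ) := by
    have : 2 * q ≤ 4 * (q / 2) := by omega
    exact_mod_cast this
  show ((2 * q : ℕ) : ℝ) ≤ 4 * Real.log ((q ^ V : ℕ) : ℝ) ^ A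
  exact hcast.trans (by have := hreach; simp only [] at this; linarith)

/-- Row 3, lower side: polylog ranges are Siegel-inert for the `4 ∣ q` family too.
[cite: MontgomeryVaughan2007, Cor. 11.15] -/
theorem not_rangeReachingZerosFour_polylog {A : ℝ} (hA : 0 < A) :
    ¬ RangeReachingZerosFour (fun N => Real.log N ^ A) := fun h =>
  not_rangeReachingZeros_polylog hA (by norm_num : (0 : ℝ) < 4) (rangeReachingZeros_of_four_polylog h)

/-! ## Summary: one dial -/

/-- **RANGE–QUALITY EXCHANGE (summary).** Modulo Matomäki–Merikoski's Theorem 1.3: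
(1) every polynomial shift range already forces the record's finite range `Q` of the quality dial;
(2) the stretched range `exp((log N)^κ)` forces the polylog zero-free region of quality exponent
`1/κ - 1` (any `B` above it), and conversely a reaching zero has quality `(log q)^{1/κ-1}`, so for
`κ < 1/A` the obstruction is discharged by `ZeroFreeRegion A` (`A = 2024`: the record's special band
`H`); (3) polylog ranges are reached by no zero (Siegel). So a lens-5 cut of the
uniformity leaves BY SHIFT RANGE is a re-parametrisation of the G1.1 quality bands (`κ = 1/(1+A)`), and
its base range is inert. [cite: MatomakiMerikoski2023, Theorem 1.3] [cite: Zhang2022LandauSiegel, Theorem 2]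
[cite: MontgomeryVaughan2007, Cor. 11.15] -/
theorem exchange_summary (hMM : MatomakiMerikoski2023_pairCorrelation) :
    (∀ θ : ℝ, 0 < θ → UniformUpperUpTo (fun N => (N : ℝ) ^ θ) → SiegelSpectrumSplit.BoundedSiegelZeroQuality) ∧
    (∀ κ B : ℝ, 0 < κ → κ ≤ 1 → 1 / κ - 1 < B →
      UniformUpperUpTo (fun N => Real.exp (Real.log N ^ κ)) → ¬ QualityAbove B) ∧
    (∀ (A : ℕ) (B : ℝ), (A : ℝ) - 1 < B →
      Literature.NumberTheory.LFunctions.Zhang2022.Skeleton.ZeroFreeRegion A → ¬ QualityAbove B) ∧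
    (∀ (A : ℕ) (κ : ℝ), 0 < κ → κ < 1 / (A : ℝ) →
      Literature.NumberTheory.LFunctions.Zhang2022.Skeleton.ZeroFreeRegion A →
        ¬ RangeReachingZeros (fun N => Real.exp (Real.log N ^ κ))) ∧
    (∀ A : ℝ, 0 < A → ¬ RangeReachingZeros (fun N => Real.log N ^ A)) ∧
    (∀ R : ℕ → ℝ, _root_.GeneralizedHardyLittlewood → UniformUpperUpTo R ∧ UniformLowerUpTo R) :=
  ⟨fun _ hθ h => boundedSiegelZeroQuality_of_uniformUpperUpTo_pow hMM hθ h,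
   fun _ _ hκ0 hκ1 hB h => not_qualityAbove_of_uniformUpperUpTo_stretched hMM hκ0 hκ1 hB h,
   fun _ _ hB hZ => not_qualityAbove_of_zeroFreeRegion hZ hB,
   fun _ _ hκ0 hκA hZ => not_rangeReachingZeros_stretched_of_zeroFreeRegion hZ hκ0 hκA,
   fun _ hA => not_rangeReachingZeros_polylog_one hA,
   fun R h => ⟨uniformUpperUpTo_of_ghl h R, uniformLowerUpTo_of_ghl h R⟩⟩

/-! ## By-name wiring to the born items of route-Parity-SiegelSpectrumSplit -/

/-- The born uniformity leaf `UU = UniformUpperGivenFixed` (stmt-Parity-26853), under its two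
conditionings `Q` (25148) and `FU = FixedUpper` (26852), is the full-range cell of the dial: it gives
`UniformUpperUpTo R` for every `R`. [folklore] -/
theorem uniformUpperUpTo_of_uniformUpperGivenFixed (hQ : SiegelSpectrumSplit.BoundedSiegelZeroQuality)
    (hFU : SiegelSpectrumSplit.FixedUpper) (hUU : SiegelSpectrumSplit.UniformUpperGivenFixed)
    (R : ℕ → ℝ) : UniformUpperUpTo R :=
  uniformUpperUpTo_of_upperBlock (hUU hQ hFU) R

/-- Lower side: `UL = UniformLowerGivenFixed` (stmt-Parity-26864) under `Q` and `FL = FixedLower`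
(26863) gives `UniformLowerUpTo R` for every `R`. [folklore] -/
theorem uniformLowerUpTo_of_uniformLowerGivenFixed (hQ : SiegelSpectrumSplit.BoundedSiegelZeroQuality)
    (hFL : SiegelSpectrumSplit.FixedLower) (hUL : SiegelSpectrumSplit.UniformLowerGivenFixed)
    (R : ℕ → ℝ) : UniformLowerUpTo R :=
  uniformLowerUpTo_of_lowerBlock (hUL hQ hFL) R

/-- The born special band `H = HighBandZeroFree` (stmt-Parity-25906) is word for word
`ZeroFreeRegion 2024`; it excludes every quality `(log q)^B`, `B > 2023`.
[cite: Zhang2022LandauSiegel, Theorem 2] -/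
theorem not_qualityAbove_of_highBandZeroFree (hH : SiegelSpectrumSplit.HighBandZeroFree) {B : ℝ}
    (hB : 2023 < B) : ¬ QualityAbove B :=
  not_qualityAbove_of_zeroFreeRegion (A := 2024) hH (by push_cast; linarith)

/-- **`H` discharges the Matomäki–Merikoski obstruction below shift range `exp((log N)^{1/2024})`.**
[cite: Zhang2022LandauSiegel, Theorem 2] [cite: MatomakiMerikoski2023, Theorem 1.3] -/
theorem not_rangeReachingZeros_stretched_of_highBandZeroFree
    (hH : SiegelSpectrumSplit.HighBandZeroFree) {κ : ℝ} (hκ0 : 0 < κ) (hκ : κ < 1 / 2024) :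
    ¬ RangeReachingZeros (fun N => Real.exp (Real.log N ^ κ)) :=
  not_rangeReachingZeros_stretched_of_zeroFreeRegion (A := 2024) hH hκ0 (by push_cast; exact hκ)

end Summit.Parity.GeneralizedHardyLittlewood.RangeQualityExchange
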